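import Summits.BirchSwinnertonDyer.BirchSwinnertonDyer.Theses.PAdicOrder
import Summits.BirchSwinnertonDyer.BirchSwinnertonDyer.Theses.PAdicOrderV2
import Literature.NumberTheory.EllipticCurves.KatoRankBoundProofs

/-!
# Route PAdicOrder — support item `PAdicOrderKatoSideR2` (stmt-BirchSwinnertonDyer-0491)

`PAdicOrderKatoSideR2` : for `E/ℚ` (globally minimal `W`), an odd prime `p` of good ordinary
reduction and the newform `f` of `E`, `rank E(ℚ) ≤ ord_{T=0} L_p(E,T)` in `ℕ∞`
(`L_p(E,T) = padicLFunction f (unitRoot W p)`). This is K. Kato, Astérisque 295 (2004),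
Thm 18.4 (p. 281), "In particular" clause, vendored in the tree as the named fact (predicate)
`Literature.NumberTheory.EllipticCurves.kato_mordellWeilRank_le_order_padicLFunction W p (f := f)`.

This file records, sorry-free:

* `pAdicOrderKatoSideR2_iff_forall_kato_mordellWeilRank_le_order_padicLFunction`: the route decl
  is *definitionally* the universal closure (over `W, p, N, f`) of that named fact — the item is a
  pure literature leaf, not a crux;
* `pAdicOrderKatoSideR2_of_kato_divisibility`: the route decl follows from Kato's divisibility
  theorem alone (`Literature.NumberTheory.EllipticCurves.kato_divisibility`, Kato Thm 17.4:
  `X(E/ℚ_∞)` is `Λ`-torsion and `char_Λ X ∣ p^n L_p(E,T)`), every other input of the printed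
  argument being a theorem of the tree
  (`kato_mordellWeilRank_le_order_padicLFunction_of_kato_divisibility`, file
  `KatoRankBoundProofs`: cyclotomic setting, existence and finite generation of `X(E/ℚ_∞)`,
  `rank E(ℚ) ≤ rank_{ℤ_p} X/TX`, and `rank_{ℤ_p} X/TX ≤ ord_T g` for `g ∈ char_Λ X`).

Both are CONDITIONAL renderings: the one undischarged input is the XL fact `kato_divisibility`
(Euler system of Beilinson–Kato elements, explicit reciprocity law; none of Kato §12–§17 exists in
Mathlib or the tree), so the item stays open until `kato_divisibility` (equivalently, for this
item, `kato_mordellWeilRank_le_order_padicLFunction`) is discharged.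
-/

-- D-0017: single-problem summit, so `Summit.BirchSwinnertonDyer.BirchSwinnertonDyer.…` repeats a
-- namespace BY DESIGN (the `Summits` lib sets this option in `lakefile.toml`; repeated for standalone checks).
set_option linter.dupNamespace false

namespace Summit.BirchSwinnertonDyer.BirchSwinnertonDyer.Theorems

open scoped MatrixGroups ModularForm
open CongruenceSubgroup Literature.NumberTheory.EllipticCurves
  Literature.NumberTheory.EllipticCurves.ModularForms
open Summit.BirchSwinnertonDyer.BirchSwinnertonDyer.Theses.PAdicOrder

/-- **The support item is the named fact, universally closed.** The route decl
`PAdicOrderKatoSideR2` (item stmt-BirchSwinnertonDyer-0491) is, binder for binder, the statement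
`∀ W p N f, kato_mordellWeilRank_le_order_padicLFunction W p (f := f)` (K. Kato, Astérisque 295
(2004), Thm 18.4 p. 281, rank form at an odd good ordinary prime); the two sides differ only in the
position of the binders `{N} [NeZero N] (f)` relative to the hypotheses `p ≠ 2`, `IsOrdinaryAt W p`.
[cite: Kato2004, Thm 18.4] -/
theorem pAdicOrderKatoSideR2_iff_forall_kato_mordellWeilRank_le_order_padicLFunction :
    PAdicOrderKatoSideR2 ↔
      ∀ (W : WeierstrassCurve ℚ) [W.IsElliptic] [W.IsGloballyMinimal] (p : ℕ) [Fact p.Prime]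
        {N : ℕ} [NeZero N] (f : CuspForm (Gamma0 N) 2),
        kato_mordellWeilRank_le_order_padicLFunction W p (f := f) := by
  constructor
  · intro h W _ _ p _ N _ f hp hord hf
    exact h W p hp hord f hf
  · intro h W _ _ p _ hp hord N _ f hf
    exact h W p f hp hord hf

/-- **`PAdicOrderKatoSideR2` from Kato's divisibility (Thm 17.4) alone.** If, for every elliptic
`E/ℚ` (globally minimal `W`), every prime `p`, every `ℤ_p`-extension datum `(κ, γ)` of `ℚ` and
every weight-2 cusp form `f`, Kato's divisibility statement
`Literature.NumberTheory.EllipticCurves.kato_divisibility W p (κ := κ) (γ := γ) (f := f)` holds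
(its own hypotheses — `p ≠ 2`, good ordinary, `κ` cyclotomic, `γ` a matching topological
generator, `f` the newform of `E` — are inside the predicate), then
`rank E(ℚ) ≤ ord_{T=0} L_p(E,T)` at every odd good ordinary prime, i.e. the route decl holds.
The derivation is the tree theorem
`Literature.NumberTheory.EllipticCurves.kato_mordellWeilRank_le_order_padicLFunction_of_kato_divisibility`
(`rank E(ℚ) ≤ rank_{ℤ_p} X/TX ≤ ord_T g ≤ ord_T (ι g) = ord_T (p^n L_p) = ord_T L_p`;
Kato 2004 §18.5–18.10, Greenberg LNM 1716 Lemma 3.1 and p. 65). CONDITIONAL on the XL fact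
`kato_divisibility`. [cite: Kato2004, Thm 17.4 and Thm 18.4] -/
theorem pAdicOrderKatoSideR2_of_kato_divisibility
    (hkato : ∀ (W : WeierstrassCurve ℚ) [W.IsElliptic] [W.IsGloballyMinimal] (p : ℕ) [Fact p.Prime]
      (κ : ZpExtension ℚ p) (γ : Field.absoluteGaloisGroup ℚ) {N : ℕ} [NeZero N]
      (f : CuspForm (Gamma0 N) 2), kato_divisibility W p (κ := κ) (γ := γ) (f := f)) :
    PAdicOrderKatoSideR2 := by
  intro W _ _ p _ hp hord N _ f hf
  exact kato_mordellWeilRank_le_order_padicLFunction_of_kato_divisibility W p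
    (fun κ γ ↦ hkato W p κ γ f) hp hord hf

end Summit.BirchSwinnertonDyer.BirchSwinnertonDyer.Theorems

/-! ### The same item as wanted by route PAdicOrderV2 (appended 2026-08-16)

Route `PAdicOrderV2` (opened 2026-08-16) wants the same item stmt-BirchSwinnertonDyer-0491 under
its own decl `Summit.BirchSwinnertonDyer.BirchSwinnertonDyer.Theses.PAdicOrderV2.PAdicOrderKatoSideR2`,
whose body is byte-identical to the `PAdicOrder` decl (`Iff.rfl`). The two renderings above are
transported verbatim. -/

namespace Summit.BirchSwinnertonDyer.BirchSwinnertonDyer.Theorems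

open scoped MatrixGroups ModularForm
open CongruenceSubgroup Literature.NumberTheory.EllipticCurves
  Literature.NumberTheory.EllipticCurves.ModularForms

/-- The `PAdicOrderV2` and `PAdicOrder` spellings of item stmt-BirchSwinnertonDyer-0491 are the
same proposition (identical bodies; `Iff.rfl`). [folklore] -/
theorem pAdicOrderV2KatoSideR2_iff_pAdicOrderKatoSideR2 :
    Theses.PAdicOrderV2.PAdicOrderKatoSideR2 ↔ Theses.PAdicOrder.PAdicOrderKatoSideR2 :=
  Iff.rfl

/-- **The support item (route `PAdicOrderV2` spelling) is the named fact, universally closed**: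
`PAdicOrderV2.PAdicOrderKatoSideR2 ↔ ∀ W p N f, kato_mordellWeilRank_le_order_padicLFunction W p`
(K. Kato, Astérisque 295 (2004), Thm 18.4 p. 281, rank form at an odd good ordinary prime).
[cite: Kato2004, Thm 18.4] -/
theorem pAdicOrderV2KatoSideR2_iff_forall_kato_mordellWeilRank_le_order_padicLFunction :
    Theses.PAdicOrderV2.PAdicOrderKatoSideR2 ↔
      ∀ (W : WeierstrassCurve ℚ) [W.IsElliptic] [W.IsGloballyMinimal] (p : ℕ) [Fact p.Prime]
        {N : ℕ} [NeZero N] (f : CuspForm (Gamma0 N) 2),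
        kato_mordellWeilRank_le_order_padicLFunction W p (f := f) :=
  pAdicOrderV2KatoSideR2_iff_pAdicOrderKatoSideR2.trans
    pAdicOrderKatoSideR2_iff_forall_kato_mordellWeilRank_le_order_padicLFunction

/-- **`PAdicOrderV2.PAdicOrderKatoSideR2` from Kato's divisibility (Thm 17.4) alone**: the route
`PAdicOrderV2` spelling of `pAdicOrderKatoSideR2_of_kato_divisibility` (same statement, same
derivation through the tree theorem
`Literature.NumberTheory.EllipticCurves.kato_mordellWeilRank_le_order_padicLFunction_of_kato_divisibility`).
CONDITIONAL on the XL fact `kato_divisibility`. [cite: Kato2004, Thm 17.4 and Thm 18.4] -/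
theorem pAdicOrderV2KatoSideR2_of_kato_divisibility
    (hkato : ∀ (W : WeierstrassCurve ℚ) [W.IsElliptic] [W.IsGloballyMinimal] (p : ℕ) [Fact p.Prime]
      (κ : ZpExtension ℚ p) (γ : Field.absoluteGaloisGroup ℚ) {N : ℕ} [NeZero N]
      (f : CuspForm (Gamma0 N) 2), kato_divisibility W p (κ := κ) (γ := γ) (f := f)) :
    Theses.PAdicOrderV2.PAdicOrderKatoSideR2 :=
  pAdicOrderV2KatoSideR2_iff_pAdicOrderKatoSideR2.mpr
    (pAdicOrderKatoSideR2_of_kato_divisibility hkato)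

end Summit.BirchSwinnertonDyer.BirchSwinnertonDyer.Theorems
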